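import Summits.NavierStokesRegularity.NavierStokesRegularity.Theorems.PerpetualPumpThesisBesovFloorBoundEmbed
import Literature.Analysis.FunctionSpaces.LittlewoodPaleyHeatProofs
import Literature.Analysis.FunctionSpaces.FourierSobolevNormEmbeddingProofs
import Literature.Analysis.FluidPDE.TaoAveragedConjugation
import Literature.Analysis.FluidPDE.TaoCascadeProjection
import Literature.Analysis.FluidPDE.TaoMultiplierToolkit

/-!
# Stub `besovDuhamelBound` for `PerpetualPump.Thesis`, part I: the `L²(ℝ³; ℂ³) ↔ 𝓢'` bridge

Support file (part 1 of the stub `besovDuhamelBound` of line `SketchIdeator2`, crux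
stmt-NavierStokesRegularity-1832). The Besov–Duhamel a-priori bound is an estimate of the
homogeneous Besov norm `‖·‖_{Ḃ⁰_{∞,1}}` (tree: `eHomBesovNorm 0 ∞ 1`, a functional on tempered
distributions `𝓢'(ℝ³, ℂ³)`, built from the blocks `Δ̇_j = φ_j(D)` of
`Literature/Analysis/FunctionSpaces/LittlewoodPaley.lean`) along a mild solution of Tao's averaged
Navier–Stokes equation, which lives in the Hilbert space `L2C = L²(ℝ³; ℂ³)` with its own Fourier
multipliers `m(D) u = 𝓕⁻¹(m · 𝓕 u)` (T. Tao, J. Amer. Math. Soc. 29 (2016), §1.1;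
`Literature.Analysis.FluidPDE.Tao2016.fourierMultiplier`, `heat`). This file identifies the two
calculi on `L²`:

* `FA.coe_fourierMultiplier`: for a bounded symbol `g` of temperate growth, the distribution of
  `g(D) f` (Tao's `L²` multiplier) is Mathlib's `fourierMultiplierCLM g` applied to the distribution
  of `f`;
* `FA.coe_heat`: Tao's heat propagator `e^{τΔ}` on `L2C` is the tree's
  `TemperedDistribution.heatSemigroup τ` (same symbol `e^{-4π²τ|ξ|²}`), hence
  `FA.exists_eHomBesovNorm_coe_heat_le`: **`e^{τΔ}` is bounded on `Ḃ⁰_{∞,1}` uniformly in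
  `τ ≥ 0`** (BCD Lemma 2.4, tree `exists_eHomBesovNorm_heatSemigroup_le`);
* `FA.eLpNormDistrib_lpBlock_coe_le_of_forall`: the block `Δ̇_k f` of `f ∈ L²` is the bounded
  continuous function `x ↦ ∫ e^{2πi x·ξ} φ_k(ξ) f̂(ξ) dξ`, so a pointwise bound of that Fourier
  integral bounds `‖Δ̇_k f‖_{L^∞}`;
* `FA.pairing_eq_integral_cdot_fourierFn`: Parseval for Tao's *bilinear* pairing,
  `⟨u, w⟩ = ∫ û(ξ) · ŵ(-ξ) dξ`, with no realness assumption.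

## References

* H. Bahouri, J.-Y. Chemin, R. Danchin, *Fourier Analysis and Nonlinear PDE* (2011), Lemma 2.4.
* T. Tao, J. Amer. Math. Soc. 29 (2016), 601–674, §1.1.
-/

noncomputable section

open MeasureTheory TemperedDistribution Filter Topology FourierTransform
open scoped SchwartzMap ENNReal NNReal ComplexConjugate

set_option linter.dupNamespace false

namespace Summit.NavierStokesRegularity.NavierStokesRegularity.Theorems.PerpetualPumpThesis.FA

open Literature.Analysis.FunctionSpaces Literature.Analysis.FluidPDE
  Literature.Analysis.FluidPDE.Tao2016

/-! ### Tao's `L²` multipliers are Mathlib's distributional multipliers -/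

/-- **Tao's `L²` Fourier multiplier is the distributional one**: for a bounded symbol `g` of
temperate growth and `f ∈ L²(ℝ³; ℂ³)`, the distribution of `g(D) f = 𝓕⁻¹(g · 𝓕f)` is
`fourierMultiplierCLM g` applied to the distribution of `f`. -/
theorem coe_fourierMultiplier {g : EuclideanSpace ℝ (Fin 3) → ℂ} (hg : g.HasTemperateGrowth)
    (hg' : MemLp g ∞ (volume : Measure (EuclideanSpace ℝ (Fin 3)))) (f : L2C) :
    ((fourierMultiplier (hg'.toLp g) f : L2C) :
        𝓢'(EuclideanSpace ℝ (Fin 3), EuclideanSpace ℂ (Fin 3))) =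
      fourierMultiplierCLM (EuclideanSpace ℂ (Fin 3)) g
        ((f : L2C) : 𝓢'(EuclideanSpace ℝ (Fin 3), EuclideanSpace ℂ (Fin 3))) := by
  rw [fourierMultiplierCLM_coe_eq_coe hg hg' f]
  rfl

/-- The same for any `L^∞` symbol class a.e. equal to `g`. -/
theorem coe_fourierMultiplier_of_ae_eq {g : EuclideanSpace ℝ (Fin 3) → ℂ}
    (hg : g.HasTemperateGrowth) (hg' : MemLp g ∞ (volume : Measure (EuclideanSpace ℝ (Fin 3))))
    {m : Lp ℂ ∞ (volume : Measure (EuclideanSpace ℝ (Fin 3)))}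
    (hm : (m : EuclideanSpace ℝ (Fin 3) → ℂ) =ᵐ[volume] g) (f : L2C) :
    ((fourierMultiplier m f : L2C) : 𝓢'(EuclideanSpace ℝ (Fin 3), EuclideanSpace ℂ (Fin 3))) =
      fourierMultiplierCLM (EuclideanSpace ℂ (Fin 3)) g
        ((f : L2C) : 𝓢'(EuclideanSpace ℝ (Fin 3), EuclideanSpace ℂ (Fin 3))) := by
  have hm' : m = hg'.toLp g := by
    apply Lp.ext
    filter_upwards [hm, hg'.coeFn_toLp] with ξ h1 h2
    rw [h1, h2]
  rw [hm']
  exact coe_fourierMultiplier hg hg' f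

/-! ### The heat propagator -/

/-- For `τ ≥ 0`, Tao's heat symbol is the tree's heat symbol `e^{-(2π)²τ|ξ|²}`, complexified. -/
theorem heatSymbol_eq_of_nonneg {τ : ℝ} (hτ : 0 ≤ τ) :
    heatSymbol τ = fun ξ : EuclideanSpace ℝ (Fin 3) =>
      ((Literature.Analysis.UnboundedOperators.heatSymbol τ ξ : ℝ) : ℂ) := by
  funext ξ
  simp only [heatSymbol, Literature.Analysis.UnboundedOperators.heatSymbol, max_eq_left hτ]
  congr 1
  congr 1
  ring

/-- The complexified heat symbol has temperate growth for `τ ≥ 0`. -/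
theorem hasTemperateGrowth_heatSymbol {τ : ℝ} (hτ : 0 ≤ τ) :
    (heatSymbol τ : EuclideanSpace ℝ (Fin 3) → ℂ).HasTemperateGrowth := by
  rw [heatSymbol_eq_of_nonneg hτ]
  exact Literature.Analysis.UnboundedOperators.heatSymbol_hasTemperateGrowth_complex
    Literature.Analysis.UnboundedOperators.heatSymbol_hasTemperateGrowth_holds hτ

/-- **Tao's `e^{τΔ}` on `L2C` is the distributional heat semigroup** (`τ ≥ 0`). -/
theorem coe_heat {τ : ℝ} (hτ : 0 ≤ τ) (f : L2C) :
    ((heat τ f : L2C) : 𝓢'(EuclideanSpace ℝ (Fin 3), EuclideanSpace ℂ (Fin 3))) =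
      TemperedDistribution.heatSemigroup τ
        ((f : L2C) : 𝓢'(EuclideanSpace ℝ (Fin 3), EuclideanSpace ℂ (Fin 3))) := by
  rw [TemperedDistribution.heatSemigroup_eq_fourierMultiplierCLM, ← heatSymbol_eq_of_nonneg hτ]
  exact coe_fourierMultiplier (hasTemperateGrowth_heatSymbol hτ) (memLp_top_heatSymbol τ) f

/-- **The heat propagator is bounded on `Ḃ⁰_{∞,1}`, uniformly in time**: there is `C` with
`‖e^{τΔ} f‖_{Ḃ⁰_{∞,1}} ≤ C ‖f‖_{Ḃ⁰_{∞,1}}` for all `τ ≥ 0` and `f ∈ L²(ℝ³; ℂ³)` (BCD Lemma 2.4: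
the heat kernel acts on each dyadic block through an `L¹` kernel of uniformly bounded norm). -/
theorem exists_eHomBesovNorm_coe_heat_le :
    ∃ C : ℝ≥0, ∀ τ : ℝ, 0 ≤ τ → ∀ f : L2C,
      eHomBesovNorm 0 ∞ 1
          ((heat τ f : L2C) : 𝓢'(EuclideanSpace ℝ (Fin 3), EuclideanSpace ℂ (Fin 3))) ≤
        C * eHomBesovNorm 0 ∞ 1
          ((f : L2C) : 𝓢'(EuclideanSpace ℝ (Fin 3), EuclideanSpace ℂ (Fin 3))) := by
  obtain ⟨C, hC⟩ := exists_eHomBesovNorm_heatSemigroup_le (E := EuclideanSpace ℝ (Fin 3))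
    (F := EuclideanSpace ℂ (Fin 3)) ∞
  refine ⟨C, fun τ hτ f => ?_⟩
  rw [coe_heat hτ]
  exact hC 0 1 τ hτ _

/-! ### The blocks of an `L²` field as Fourier integrals -/

/-- The dyadic symbol times the Fourier transform of an `L²` field is integrable (compact
support, `L²`). -/
theorem integrable_dyadicSymbol_smul_fourierFn (k : ℤ) (f : L2C) :
    Integrable (fun ξ : EuclideanSpace ℝ (Fin 3) => dyadicSymbol k ξ • fourierFn f ξ) volume := by
  have hK : IsCompact (tsupport (dyadicSymbol (E := EuclideanSpace ℝ (Fin 3)) k)) :=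
    hasCompactSupport_dyadicSymbol k
  have hf2 : MemLp (fourierFn f) 2 (volume : Measure (EuclideanSpace ℝ (Fin 3))) := Lp.memLp _
  -- restrict to the compact support, where `L² ⊂ L¹`
  have hsupp : (Function.support fun ξ : EuclideanSpace ℝ (Fin 3) =>
      dyadicSymbol k ξ • fourierFn f ξ) ⊆ tsupport (dyadicSymbol (E := EuclideanSpace ℝ (Fin 3)) k) := by
    intro ξ hξ
    apply subset_tsupport
    rw [Function.mem_support] at hξ ⊢
    intro h
    exact hξ (by rw [h, zero_smul])
  rw [← integrableOn_iff_integrable_of_support_subset hsupp]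
  have hmeas : AEStronglyMeasurable (fun ξ : EuclideanSpace ℝ (Fin 3) =>
      dyadicSymbol k ξ • fourierFn f ξ) volume :=
    (contDiff_dyadicSymbol k).continuous.aestronglyMeasurable.smul (Lp.memLp _).1
  refine Integrable.mono' (g := fun ξ => 2 * ‖fourierFn f ξ‖) ?_ hmeas.restrict
    (ae_of_all _ fun ξ => ?_)
  · refine Integrable.const_mul ?_ 2
    exact (memLp_one_iff_integrable.1 ((hf2.restrict _).mono_exponent_of_measure_support_ne_top
      (s := Set.univ) (fun x hx => (hx (Set.mem_univ x)).elim) (by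
        rw [Measure.restrict_apply_univ]; exact hK.measure_lt_top.ne) one_le_two)).norm
  · rw [norm_smul]
    exact mul_le_mul_of_nonneg_right (norm_dyadicSymbol_le_two k ξ) (norm_nonneg _)

/-- The dyadic symbol times the Fourier transform of an `L²` field is square integrable. -/
theorem memLp_two_dyadicSymbol_smul_fourierFn (k : ℤ) (f : L2C) :
    MemLp (fun ξ : EuclideanSpace ℝ (Fin 3) => dyadicSymbol k ξ • fourierFn f ξ) 2 volume := by
  have h := MemLp.smul (p := ∞) (q := 2) (r := 2) (Lp.memLp (𝓕 f : L2C))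
    (memLp_top_dyadicSymbol (E := EuclideanSpace ℝ (Fin 3)) k)
  exact h

/-- **The block of an `L²` field is a Fourier integral**: `Δ̇_k f` is the distribution of the
`L²` class of `x ↦ ∫ e^{2πi x·ξ} φ_k(ξ) f̂(ξ) dξ`. -/
theorem lpBlock_coe_eq (k : ℤ) (f : L2C) :
    lpBlock k ((f : L2C) : 𝓢'(EuclideanSpace ℝ (Fin 3), EuclideanSpace ℂ (Fin 3))) =
      (((𝓕⁻ ((memLp_two_dyadicSymbol_smul_fourierFn k f).toLp _) : L2C) : L2C) :
        𝓢'(EuclideanSpace ℝ (Fin 3), EuclideanSpace ℂ (Fin 3))) := by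
  rw [lpBlock_apply, fourierMultiplierCLM_coe_eq_coe (hasTemperateGrowth_dyadicSymbol k)
    (memLp_top_dyadicSymbol k) f]
  congr 2
  apply Lp.ext
  filter_upwards [Lp.coeFn_lpSMul (r := 2) ((memLp_top_dyadicSymbol
      (E := EuclideanSpace ℝ (Fin 3)) k).toLp _) (𝓕 f : L2C),
    (memLp_top_dyadicSymbol (E := EuclideanSpace ℝ (Fin 3)) k).coeFn_toLp,
    (memLp_two_dyadicSymbol_smul_fourierFn k f).coeFn_toLp] with ξ h1 h2 h3
  rw [h1, Pi.smul_apply', h2, h3]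
  rfl

/-- **Pointwise bounds of the block Fourier integral bound `‖Δ̇_k f‖_{L^∞}`**: if
`‖∫ e^{2πi x·ξ} φ_k(ξ) f̂(ξ) dξ‖ ≤ B` for every `x`, then `‖Δ̇_k f‖_{L^∞} ≤ B` (`f ∈ L²(ℝ³; ℂ³)`). -/
theorem eLpNormDistrib_lpBlock_coe_le_of_forall (k : ℤ) (f : L2C) {B : ℝ≥0∞}
    (hB : ∀ x : EuclideanSpace ℝ (Fin 3),
      ‖𝓕⁻ (fun ξ : EuclideanSpace ℝ (Fin 3) => dyadicSymbol k ξ • fourierFn f ξ) x‖ₑ ≤ B) :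
    eLpNormDistrib ∞ (lpBlock k ((f : L2C) :
      𝓢'(EuclideanSpace ℝ (Fin 3), EuclideanSpace ℂ (Fin 3)))) ≤ B := by
  rw [lpBlock_coe_eq k f, F.eLpNormDistrib_coe_two_eq_eLpNorm,
    eLpNorm_congr_ae (SobolevEmbeddingHalf.fourierInv_toLp_ae_eq_fourierIntegralInv
      (integrable_dyadicSymbol_smul_fourierFn k f) (memLp_two_dyadicSymbol_smul_fourierFn k f)),
    eLpNorm_exponent_top]
  exact eLpNormEssSup_le_of_ae_enorm_bound (ae_of_all _ hB)

/-! ### Parseval for the bilinear pairing -/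

/-- `⟪conj a, b⟫ = a · b` on `ℂ³` (the sesquilinear inner product of a conjugated vector is the
bilinear dot product). -/
theorem inner_conj3_left (a b : EuclideanSpace ℂ (Fin 3)) : inner ℂ (conj3 a) b = cdot a b := by
  simp only [cdot, PiLp.inner_apply, conj3_apply, RCLike.inner_apply, starRingEnd_self_apply]
  refine Finset.sum_congr rfl fun i _ => ?_
  ring

/-- **Parseval for Tao's bilinear pairing**: `⟨u, w⟩ = ∫ û(ξ) · ŵ(-ξ) dξ` for all
`u, w ∈ L²(ℝ³; ℂ³)` (no realness needed: `⟨u, w⟩ = ⟪w̄, u⟫` and `𝓕 w̄ = conj ((𝓕 w)(-·))`). -/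
theorem pairing_eq_integral_cdot_fourierFn (u w : L2C) :
    pairing u w = ∫ ξ : EuclideanSpace ℝ (Fin 3), cdot (fourierFn w (-ξ)) (fourierFn u ξ) := by
  rw [pairing_eq_inner_conjL2, inner_eq_integral_fourierFn]
  refine integral_congr_ae ?_
  filter_upwards [fourierFn_conjL2 w] with ξ hξ
  rw [hξ, inner_conj3_left]

end Summit.NavierStokesRegularity.NavierStokesRegularity.Theorems.PerpetualPumpThesis.FA

namespace Summit.NavierStokesRegularity.NavierStokesRegularity.Theorems.PerpetualPumpThesis

open Literature.Analysis.FluidPDE Literature.Analysis.FluidPDE.Tao2016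
open Literature.Analysis.FunctionSpaces

/-- **Part Bridge of stub `besovDuhamelBound` (registered sub-goal `stub_FA_Bridge`)**: Tao's heat
propagator `e^{τΔ}` on `L²(ℝ³; ℂ³)` is bounded on the homogeneous Besov space `Ḃ⁰_{∞,1}`,
uniformly in `τ ≥ 0`: `‖e^{τΔ} f‖_{Ḃ⁰_{∞,1}} ≤ C ‖f‖_{Ḃ⁰_{∞,1}}` (BCD Lemma 2.4; the linear part
of the Besov–Duhamel estimate of line `SketchIdeator2`). -/
theorem stub_FA_Bridge : ∃ C : NNReal, ∀ τ : ℝ, 0 ≤ τ → ∀ f : L2C, eHomBesovNorm 0 ⊤ 1 ((heat τ f : L2C) : 𝓢'(EuclideanSpace ℝ (Fin 3), EuclideanSpace ℂ (Fin 3))) ≤ (C : ENNReal) * eHomBesovNorm 0 ⊤ 1 ((f : L2C) : 𝓢'(EuclideanSpace ℝ (Fin 3), EuclideanSpace ℂ (Fin 3))) :=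
  FA.exists_eHomBesovNorm_coe_heat_le

end Summit.NavierStokesRegularity.NavierStokesRegularity.Theorems.PerpetualPumpThesis
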